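import Summits.KontsevichZagierPeriods.KontsevichZagierPeriods.Theses.FurushoPentagon

/-!
# drefute — `stub_stuffleTelescope` of line `dilation-homotopy-transposition` (crux stmt-KontsevichZagierPeriods-3930)

The block partial-fraction identity of the stuffle side (lead's stub registered 2026-08-16T01:09:35Z):
with `Π = ∏_{l<k} a_l`, `E i = ∏_{m<i} (1 − a_{m+1})`, `F i = ∏_{i ≤ m < k} (1 − u a_{m+1})` and
`P i = u^{k−i} Π / (E i · F i)` one has `A = P k`, `u·B = P 0`, and
`(P (i+1) − P i)/(1 − u) = g_i + h_i` (closed forms of the two dissection pieces), so the difference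
quotient telescopes.
-/

noncomputable section
set_option linter.dupNamespace false
open Finset

namespace Summit.KontsevichZagierPeriods.KontsevichZagierPeriods.Cruxes.HoffmanRelationInKZ.DrefuteTelescope

variable (k : ℕ) (u : ℝ) (a : ℕ → ℝ)

/-- `Π = ∏_{l<k} a_l`. -/
def Pr : ℝ := ∏ l ∈ range k, a l
/-- `E i = ∏_{m<i} (1 − a_{m+1})`. -/
def E (i : ℕ) : ℝ := ∏ m ∈ range i, (1 - a (m + 1))
/-- `F i = ∏_{i ≤ m < k} (1 − u a_{m+1})`. -/
def F (i : ℕ) : ℝ := ∏ m ∈ Ico i k, (1 - u * a (m + 1))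
/-- `P i = u^{k−i} Π / (E i F i)`. -/
def P (i : ℕ) : ℝ := u ^ (k - i) * Pr k a / (E a i * F k u a i)

variable {k u a}

theorem E_succ (i : ℕ) : E a (i + 1) = E a i * (1 - a (i + 1)) := by
  rw [E, E, prod_range_succ]

theorem F_bot {i : ℕ} (hi : i < k) : F k u a i = (1 - u * a (i + 1)) * F k u a (i + 1) := by
  rw [F, F, prod_eq_prod_Ico_succ_bot hi]

theorem F_top : F k u a k = 1 := by simp [F]

theorem E_zero : E a 0 = 1 := by simp [E]

theorem F_zero : F k u a 0 = ∏ m ∈ range k, (1 - u * a (m + 1)) := by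
  rw [F, range_eq_Ico]

section Pos

theorem one_sub_pos (ha : ∀ j, 1 ≤ j → a j < 1) (m : ℕ) : 0 < 1 - a (m + 1) :=
  sub_pos.mpr (ha _ (by omega))

theorem one_sub_mul_pos (hu0 : 0 < u) (hu1 : u < 1) (ha : ∀ j, 1 ≤ j → a j < 1) (m : ℕ) :
    0 < 1 - u * a (m + 1) := by
  have := ha (m + 1) (by omega)
  nlinarith

theorem E_pos (ha : ∀ j, 1 ≤ j → a j < 1) (i : ℕ) : 0 < E a i :=
  prod_pos fun m _ => one_sub_pos ha m

theorem F_pos (hu0 : 0 < u) (hu1 : u < 1) (ha : ∀ j, 1 ≤ j → a j < 1) (i : ℕ) : 0 < F k u a i :=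
  prod_pos fun m _ => one_sub_mul_pos hu0 hu1 ha m

end Pos

/-! ### Counting the `u`'s -/

theorem prod_ite_le_one (i : ℕ) (hi : i < k) :
    ∏ l ∈ range k, (if l ≤ i then (1:ℝ) else u) = u ^ (k - 1 - i) := by
  rw [prod_ite, prod_const_one, one_mul, prod_const]
  congr 1
  have : (range k).filter (fun l => ¬ l ≤ i) = Ico (i + 1) k := by
    ext l; simp [mem_Ico]; omega
  rw [this, Nat.card_Ico]; omega

theorem prod_ite_eq_zero :
    ∏ l ∈ range k, (if l = 0 then (1:ℝ) else u) = u ^ (k - 1) := by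
  rw [prod_ite, prod_const_one, one_mul, prod_const]
  congr 1
  have : (range k).filter (fun l => ¬ l = 0) = Ico 1 k := by
    ext l; simp [mem_Ico]; omega
  rw [this, Nat.card_Ico]

/-! ### Closed forms -/

theorem closed_A : ∏ l ∈ range k, a l / (1 - a (l + 1)) = Pr k a / E a k := by
  rw [prod_div_distrib]; rfl

theorem closed_B :
    ∏ l ∈ range k, (if l = 0 then 1 else u) * a l / (1 - u * a (l + 1)) = u ^ (k - 1) * Pr k a / F k u a 0 := by
  rw [prod_div_distrib, prod_mul_distrib, prod_ite_eq_zero, F_zero]; rfl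

theorem closed_g (i : ℕ) (hi : i < k) :
    ∏ l ∈ range k, (if l ≤ i then a l else u * a l) / (1 - (if l + 1 ≤ i then a (l + 1) else u * a (l + 1))) =
      u ^ (k - 1 - i) * Pr k a / (E a i * F k u a i) := by
  rw [prod_div_distrib]
  congr 1
  · have : ∀ l, (if l ≤ i then a l else u * a l) = (if l ≤ i then (1:ℝ) else u) * a l := by
      intro l; split_ifs <;> ring
    simp_rw [this]
    rw [prod_mul_distrib, prod_ite_le_one i hi]; rfl
  · have : ∀ l, (1 - (if l + 1 ≤ i then a (l + 1) else u * a (l + 1))) =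
        (if l + 1 ≤ i then (1 - a (l + 1)) else (1 - u * a (l + 1))) := by
      intro l; split_ifs <;> rfl
    simp_rw [this]
    rw [prod_ite]
    have h1 : (range k).filter (fun l => l + 1 ≤ i) = range i := by
      ext l; simp; omega
    have h2 : (range k).filter (fun l => ¬ (l + 1 ≤ i)) = Ico i k := by
      ext l; simp [mem_Ico]; omega
    rw [h1, h2]; rfl

theorem closed_h (i : ℕ) (hi : i < k) :
    ∏ l ∈ range (k + 1), (if l ≤ i + 1 then a l else u * a (l - 1)) / (1 - (if l ≤ i then a (l + 1) else u * a l)) =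
      u ^ (k - 1 - i) * Pr k a * a (i + 1) / (E a (i + 1) * F k u a i) := by
  rw [prod_div_distrib]
  congr 1
  · rw [prod_ite]
    have h1 : (range (k + 1)).filter (fun l => l ≤ i + 1) = range (i + 2) := by
      ext l; simp; omega
    have h2 : (range (k + 1)).filter (fun l => ¬ (l ≤ i + 1)) = Ico (i + 2) (k + 1) := by
      ext l; simp [mem_Ico]; omega
    rw [h1, h2, prod_mul_distrib, prod_const, Nat.card_Ico]
    have h3 : ∏ l ∈ Ico (i + 2) (k + 1), a (l - 1) = ∏ m ∈ Ico (i + 1) k, a m := by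
      rw [← prod_Ico_add' (fun x => a (x - 1)) (i + 1) k 1]
      exact prod_congr rfl fun m _ => by simp
    rw [h3, prod_range_succ, show k + 1 - (i + 2) = k - 1 - i by omega]
    have h4 : (∏ x ∈ range (i + 1), a x) * ∏ m ∈ Ico (i + 1) k, a m = Pr k a :=
      prod_range_mul_prod_Ico _ (by omega)
    calc (∏ x ∈ range (i + 1), a x) * a (i + 1) * (u ^ (k - 1 - i) * ∏ m ∈ Ico (i + 1) k, a m)
        = u ^ (k - 1 - i) * ((∏ x ∈ range (i + 1), a x) * ∏ m ∈ Ico (i + 1) k, a m) * a (i + 1) := by ring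
      _ = u ^ (k - 1 - i) * Pr k a * a (i + 1) := by rw [h4]
  · have : ∀ l, (1 - (if l ≤ i then a (l + 1) else u * a l)) =
        (if l ≤ i then (1 - a (l + 1)) else (1 - u * a l)) := by
      intro l; split_ifs <;> rfl
    simp_rw [this]
    rw [prod_ite]
    have h1 : (range (k + 1)).filter (fun l => l ≤ i) = range (i + 1) := by
      ext l; simp; omega
    have h2 : (range (k + 1)).filter (fun l => ¬ (l ≤ i)) = Ico (i + 1) (k + 1) := by
      ext l; simp [mem_Ico]; omega
    rw [h1, h2]
    have h3 : ∏ l ∈ Ico (i + 1) (k + 1), (1 - u * a l) = F k u a i := by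
      rw [F, ← prod_Ico_add' (fun x => 1 - u * a x) i k 1]
    rw [h3]; rfl

/-! ### The telescoping step -/

theorem step (hu0 : 0 < u) (hu1 : u < 1) (ha : ∀ j, 1 ≤ j → a j < 1) (i : ℕ) (hi : i < k) :
    (P k u a (i + 1) - P k u a i) / (1 - u) =
      u ^ (k - 1 - i) * Pr k a / (E a i * F k u a i) +
        u ^ (k - 1 - i) * Pr k a * a (i + 1) / (E a (i + 1) * F k u a i) := by
  have hE : E a i ≠ 0 := (E_pos ha i).ne'
  have hF : F k u a (i + 1) ≠ 0 := (F_pos hu0 hu1 ha (i + 1)).ne'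
  have h1 : 1 - a (i + 1) ≠ 0 := (one_sub_pos ha i).ne'
  have h2 : 1 - u * a (i + 1) ≠ 0 := (one_sub_mul_pos hu0 hu1 ha i).ne'
  have h3 : (1 - u) ≠ 0 := (sub_pos.mpr hu1).ne'
  have h2' : 1 - a (i + 1) * u ≠ 0 := by rw [mul_comm]; exact h2
  rw [P, P, E_succ, F_bot hi, show k - i = (k - 1 - i) + 1 by omega, show k - (i + 1) = k - 1 - i by omega,
    pow_succ]
  rw [div_add_div _ _ (mul_ne_zero hE (mul_ne_zero h2 hF)) (mul_ne_zero (mul_ne_zero hE h1) (mul_ne_zero h2 hF)),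
    div_sub_div _ _ (mul_ne_zero (mul_ne_zero hE h1) hF) (mul_ne_zero hE (mul_ne_zero h2 hF)), div_div,
    div_eq_div_iff (mul_ne_zero (mul_ne_zero (mul_ne_zero (mul_ne_zero hE h1) hF) (mul_ne_zero hE (mul_ne_zero h2 hF))) h3)
      (mul_ne_zero (mul_ne_zero hE (mul_ne_zero h2 hF)) (mul_ne_zero (mul_ne_zero hE h1) (mul_ne_zero h2 hF)))]
  ring

/-- **`stub_stuffleTelescope` of the lead's skeleton, PROVED** (registered signature copied verbatim). -/
theorem stub_stuffleTelescope_proof : ∀ (k : ℕ), 1 ≤ k → ∀ (u : ℝ), 0 < u → u < 1 → ∀ (a : ℕ → ℝ), (∀ j, 1 ≤ j → a j < 1) → ((∏ l ∈ Finset.range k, a l / (1 - a (l + 1))) - u * ∏ l ∈ Finset.range k, (if l = 0 then 1 else u) * a l / (1 - u * a (l + 1))) / (1 - u) = ∑ i ∈ Finset.range k, ((∏ l ∈ Finset.range k, (if l ≤ i then a l else u * a l) / (1 - (if l + 1 ≤ i then a (l + 1) else u * a (l + 1)))) + ∏ l ∈ Finset.range (k + 1), (if l ≤ i + 1 then a l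 else u * a (l - 1)) / (1 - (if l ≤ i then a (l + 1) else u * a l))) := by
  intro k hk u hu0 hu1 a ha
  -- both sides as the telescope of `P`
  have hL : ((∏ l ∈ range k, a l / (1 - a (l + 1))) -
      u * ∏ l ∈ range k, (if l = 0 then 1 else u) * a l / (1 - u * a (l + 1))) = P k u a k - P k u a 0 := by
    rw [closed_A, closed_B, P, P, Nat.sub_self, pow_zero, one_mul, F_top, mul_one, Nat.sub_zero, E_zero,
      one_mul, show u ^ k = u * u ^ (k - 1) by rw [← pow_succ']; congr 1; omega]
    ring
  rw [hL, ← sum_range_sub (P k u a) k, sum_div]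
  refine sum_congr rfl fun i hi => ?_
  rw [mem_range] at hi
  rw [step hu0 hu1 ha i hi, closed_g i hi, closed_h i hi]

end Summit.KontsevichZagierPeriods.KontsevichZagierPeriods.Cruxes.HoffmanRelationInKZ.DrefuteTelescope
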